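import Summits.BirchSwinnertonDyer.Rank1Residual.X11b.KolyvaginH44OfTraceRelation
import Summits.BirchSwinnertonDyer.BirchSwinnertonDyer.Theorems.SylvesterTwoHeegnerIndexUpperOffV0H44LocalizedSupersingular
import HarnessLib

/-!
# K7t crux `UpperOffV0HSYPlus` (item 19804), line `offv0-kolyvagin2`, the `2`-adic local clause `h44`,
# layer 3: x11b3's consumer glue `h44_of_traceRelation_of_congruence_of_dvd` at SUPERSINGULAR primes

Helper file of route `SylvesterTwoHeegnerIndex` (cell bsd-cm, rung K7t): x11b3's
`KolyvaginH44.h44_of_traceRelation_of_congruence_of_dvd` (`X11b/KolyvaginH44OfTraceRelation`: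
`h44_of_prop37_of_dvd ∘ h37_of_traceRelation_of_congruence`) token for token, with `(hp2) (hW)`
replaced by `hss` («`a_ℓ(W) = 0` at every Kolyvagin prime of level `p^M`») and the END call replaced
by k7t-c2 g6's `h44_of_prop37_of_dvd_of_supersingular`.  Pass-through plumbing (x11b3's text,
credited there); (γ) / `h44` NOT discharged; no definition, no named fact, no `sorry`; B14 = O12 open
as a class; BSD not claimed.  References: [GrossLMS1991] Prop. 3.7 (1)(2); [McCallumLMS1991] Prop. 4.4.
-/

set_option autoImplicit false
set_option linter.dupNamespace false

noncomputable section

open scoped Classical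
open WeierstrassCurve Field NumberField IsDedekindDomain Finset
open Literature.NumberTheory.EllipticCurves Literature.NumberTheory.GaloisRepresentations
open Literature.NumberTheory.EllipticCurves.KolyvaginCocycle
open Literature.NumberTheory.EllipticCurves.KolyvaginEuler
open Literature.NumberTheory.EllipticCurves.RingClassField
open Literature.NumberTheory.EllipticCurves.ModularForms
open Summit.BirchSwinnertonDyer.Rank1Residual.X11b
open Summit.BirchSwinnertonDyer.Rank1Residual.X11b.KolyvaginH44

namespace Summit.BirchSwinnertonDyer.BirchSwinnertonDyer.Theorems.SylvesterTwoUpper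

-- `K : Type`: the tree's ring-class class field theory is universe `0`.
variable {K : Type} [Field K] [NumberField K] {N : ℕ} {W : WeierstrassCurve ℚ}

/-- **`h44` at the divisors of a top level from the trace relation and the Eichler–Shimura
congruence (γ) on coherent concrete Kolyvagin–Heegner data, at SUPERSINGULAR Kolyvagin primes, any
prime `p`** (x11b3's `h44_of_traceRelation_of_congruence_of_dvd`, `hp2`/`hW` → `hss`).
[cite: GrossLMS1991, Prop. 3.7 (1)(2), Prop. 3.6, §4 (4.1)] [cite: McCallumLMS1991, Prop. 4.4, Lemma 4.3] -/
theorem h44_of_traceRelation_of_congruence_of_dvd_of_supersingular {N : ℕ} {W : WeierstrassCurve ℚ}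
    [NeZero N] [W.IsElliptic] [W.IsGloballyMinimal]
    (hK : IsImaginaryQuadratic K) (ι : K →+* ℂ)
    {P : (W.baseChange K).toAffine.Point} (hHP : IsHeegnerPoint N W K P)
    {p M : ℕ} (hp : p.Prime) (hM : 1 ≤ M)
    (hss : ∀ ℓ : ℕ, IsKolyvaginPrime N W K p ℓ → FrobEqFrobInfty W K (p ^ M) ℓ →
      W.frobeniusTrace ℓ = 0)
    (hdiv : ∀ Q : geomPoints (W.baseChange K), ∃ R, ((p ^ M : ℕ) : ℤ) • R = Q)
    {𝒢 : ℕ → Type*} [∀ m, CommGroup (𝒢 m)] {A₀ : ℕ → Type*} [∀ m, AddCommGroup (A₀ m)]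
    [∀ m, DistribMulAction (𝒢 m) (A₀ m)]
    (σ : ∀ m, ℕ → 𝒢 m) (L : ℕ → Finset ℕ) (H : ∀ m, Subgroup (𝒢 m))
    [∀ m, Fintype (𝒢 m ⧸ H m)] (f : ∀ m, 𝒢 m ⧸ H m → 𝒢 m)
    (hord : ∀ m, ∀ ℓ ∈ L m, σ m ℓ ^ (ℓ + 1) = 1)
    (y : ∀ m, A₀ m)
    (π : ∀ m, absoluteGaloisGroup K →* 𝒢 m) (j : ∀ m, A₀ m →+ geomPoints (W.baseChange K))
    (hj : ∀ m (g : absoluteGaloisGroup K) (a : A₀ m), j m (π m g • a) = g • j m a)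
    (hA : ∀ m, IsAdmissible (absoluteGaloisGroup K) (j m).range ((p ^ M : ℕ) : ℤ))
    (hPt : ∀ m, j m (kolyvaginPoint (σ m) (L m) (f m) (y m)) ∈
      invPoints (absoluteGaloisGroup K) (j m).range ((p ^ M : ℕ) : ℤ))
    (hI : ∀ m : ℕ, ∀ v : HeightOneSpectrum (𝓞 K), (m : 𝓞 K) ∉ v.asIdeal →
      ∀ 𝔐 ∈ v.localPrimesAbove, ∀ t ∈ 𝔐.inertia (absoluteGaloisGroup (v.adicCompletion K)),
        resGal (K := K) (v.adicCompletion K) t • j m (kolyvaginPoint (σ m) (L m) (f m) (y m)) =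
          j m (kolyvaginPoint (σ m) (L m) (f m) (y m)))
    {n : ℕ}
    (e : ∀ m, ringClassField K ι m →ₐ[K] AlgebraicClosure K)
    (ρ : ∀ m, 𝒢 m →* (ringClassField K ι m ≃ₐ[ℚ] ringClassField K ι m))
    (hρ : ∀ m, Function.Injective (ρ m))
    (hπρ : ∀ m (τ : absoluteGaloisGroup K) (x : ringClassField K ι m),
      τ • e m x = e m (ρ m (π m τ) x))
    (Dt : ModularParametrizationData W N) {β : ℤ}
    (hND : IsCoprime (N : ℤ) (NumberField.discr K)) (hD : NumberField.discr K < -4)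
    (d : (m : ℕ) → m ∣ n → KolyvaginHeegnerData Dt β ι m)
    (hcoh : ∀ (m : ℕ) (hm : m ∣ n) (ℓ : ℕ) (hℓ : ℓ ∈ m.primeFactors)
      (hle : ringClassField K ι (m / ℓ) ≤ ringClassField K ι m),
      letI : Algebra K ℂ := ι.toAlgebra
      (d m hm).toGeomPoints
          (KolyvaginOperator.derivedPoint (pointGalHom W (ringClassField K ι m)) (d m hm).σ (m / ℓ)
            (d m hm).S
            (WeierstrassCurve.Affine.Point.map (W' := W)
              ((RingClassField.inclusion ι hle).restrictScalars ℚ)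
              (d (m / ℓ) ((Nat.div_dvd_of_dvd (Nat.dvd_of_mem_primeFactors hℓ)).trans hm)).y)) =
        (d (m / ℓ) ((Nat.div_dvd_of_dvd (Nat.dvd_of_mem_primeFactors hℓ)).trans hm)).toGeomPoints
          (d (m / ℓ) ((Nat.div_dvd_of_dvd (Nat.dvd_of_mem_primeFactors hℓ)).trans hm)).derivedPoint)
    (hγ : ∀ (m : ℕ) (hm : m ∣ n) (ℓ : ℕ) (hℓ : ℓ ∈ m.primeFactors) [Fact ℓ.Prime]
      (hΔ : ¬ (ℓ : ℤ) ∣ minimalDiscriminantInt W) (φ₀ : absoluteGaloisGroup (ZMod ℓ)),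
      (∀ x : AlgebraicClosure (ZMod ℓ), φ₀ • x = x ^ ℓ) →
      ∀ (hle : ringClassField K ι (m / ℓ) ≤ ringClassField K ι m)
        (γ : ringClassField K ι m ≃ₐ[ℚ] ringClassField K ι m), γ ∈ ringClassGal ι m →
        geomReduction hΔ ((RatClosure.pointsEquiv (K := K) W).symm
            ((d m hm).toGeomPoints (pointGalHom W (ringClassField K ι m) γ (d m hm).y))) =
          φ₀ • geomReduction hΔ ((RatClosure.pointsEquiv (K := K) W).symm
            ((d m hm).toGeomPoints (pointGalHom W (ringClassField K ι m) γ
              (WeierstrassCurve.Affine.Point.map (W' := W)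
                ((RingClassField.inclusion ι hle).restrictScalars ℚ)
                (d (m / ℓ) ((Nat.div_dvd_of_dvd (Nat.dvd_of_mem_primeFactors hℓ)).trans hm)).y)))))
    (iA : ∀ m, A₀ m ≃+ (W.baseChange (ringClassField K ι m)).toAffine.Point)
    (hiA : ∀ (m : ℕ), m ∣ n → ∀ (g : 𝒢 m) (a : A₀ m),
      iA m (g • a) = pointGalHom W (ringClassField K ι m) (ρ m g) (iA m a))
    (hjA : ∀ (m : ℕ) (hm : m ∣ n) (a : A₀ m), j m a = (d m hm).toGeomPoints (iA m a))
    (hyA : ∀ (m : ℕ) (hm : m ∣ n), iA m (y m) = (d m hm).y)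
    (hσA : ∀ (m : ℕ) (hm : m ∣ n), ∀ q ∈ m.primeFactors, ρ m (σ m q) = (d m hm).σ q)
    (hL : ∀ m : ℕ, m ∣ n → L m = m.primeFactors)
    (hfsec : ∀ m : ℕ, m ∣ n → ∀ c : 𝒢 m ⧸ H m, (f m c : 𝒢 m ⧸ H m) = c)
    (hfS : ∀ (m : ℕ) (hm : m ∣ n) (c : 𝒢 m ⧸ H m), ρ m (f m c) ∈ (d m hm).S)
    (hHρ : ∀ m : ℕ, m ∣ n → ∀ h ∈ H m, ρ m h ∈ ringClassGalOver ι m 1)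
    (h𝒢ρ : ∀ m : ℕ, m ∣ n → ∀ g : 𝒢 m, ρ m g ∈ ringClassGal ι m)
    (hSρ : ∀ (m : ℕ) (hm : m ∣ n), ((d m hm).S : Set _) ⊆ Set.range (ρ m)) :
    ∀ m : ℕ, m ∣ n → Squarefree m →
      (∀ q ∈ m.primeFactors, IsKolyvaginPrime N W K p q ∧ FrobEqFrobInfty W K (p ^ M) q) →
      ∀ ℓ : ℕ, ℓ.Prime → ℓ ∣ m → ∀ v : HeightOneSpectrum (𝓞 K), (ℓ : 𝓞 K) ∈ v.asIdeal →
        ∀ a : ℕ, (((p : ℤ) ^ a) • kolyvaginClass (W.baseChange K) _ hdiv (hA m)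
              (j m (kolyvaginPoint (σ m) (L m) (f m) (y m))) (hPt m) ∈
            selmerLocalKer (W.baseChange K) (v.adicCompletion K) ((p ^ M : ℕ) : ℤ) ↔
          ((p : ℤ) ^ a) • kolyvaginClass (W.baseChange K) _ hdiv (hA (m / ℓ))
              (j (m / ℓ) (kolyvaginPoint (σ (m / ℓ)) (L (m / ℓ)) (f (m / ℓ)) (y (m / ℓ))))
              (hPt (m / ℓ)) ∈
            (W.baseChange K).torsionLocalKer (v.adicCompletion K) ((p ^ M : ℕ) : ℤ)) :=
  h44_of_prop37_of_dvd_of_supersingular hK ι hHP hp hM hss hdiv σ L H f hord y π j hj hA hPt hI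
    (KolyvaginH37Bridge.h37_of_traceRelation_of_congruence hK ι Dt p M hND hD d hcoh hγ σ L H f y j
      ρ hρ iA hiA hjA hyA hσA hL hfsec hfS hHρ h𝒢ρ hSρ)
    e ρ hρ hπρ (KolyvaginH37Bridge.map_zpowers_eq_ringClassGalOver_of_dvd ι Dt d σ ρ hσA)

end Summit.BirchSwinnertonDyer.BirchSwinnertonDyer.Theorems.SylvesterTwoUpper

end
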